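import Summits.ResolutionOfSingularities.ResolutionOfSingularities.Theorems.HomologicalConductorNoZenoCoarseningLU
import Summits.ResolutionOfSingularities.ResolutionOfSingularities.Theorems.HomologicalConductorNoZenoParasiteLocPrime
import Literature.AlgebraicGeometry.Resolution.QuasiExcellentSchemes
import Literature.AlgebraicGeometry.Resolution.ExcellentRingsFieldProofs
import HarnessLib

/-!
# Crux `NoZenoR` / `NoZeno` (stmt-ResolutionOfSingularities-19943 / -16483): (LU₂W) `Sig.UnionLU` PROVED,
# and LU₂ along a THREAD — the `hLU` input of the exhaustive habitat entry, modulo `CossartJannsenSaito2020`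

`[OURS · L W4.4]` Cell res-hironaka, crux chain W4.4, seat res-L0-w44-stub-1 (gen 8); support-level,
counted 0.  Nothing here is a statement of the manuscript under review (Hironaka 2017); AI-written,
weaker than expert review.  Sequel of `…NoZenoCoarseningLU` (the valuation-theoretic core
`exists_regular_two_dominated_of_cjs`); here the residually transcendental element is read off a
thread of the canonical tower, and res-L0-w44-stub-3's `hLU` binder (re-cut 2026-08-27T13:32Z) of
`NoZeno.Sandwiched.exists_isSandwichedGerm_of_exhausts` is produced verbatim.

* **`unionLU`** — planner res-L0-w44-plan-1's r3.3 `Beta2Descent.Sig.UnionLU` (the (LU₂W) conjunct of the entry cut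
  `habExSw0_of_cut : CJS-General → (TD) → (LU₂W) → (UE) → (NDT) → Sig.stub_HabExSw₀`) PROVED, TEXT VERBATIM:
  `CossartJannsenSaito2020General.{0} → ∀ k K W, k ⊆ W → K/k f.g. → tr.deg_k K = 3 →
   (∃ w ∈ W, ∀ f ≠ 0, W.valuation (aeval w f) = 1) → ¬ (W ess.-f.t.) → ∃ R, … dim R = 2 …`
  (CJS-General + the tree THEOREM `Stacks07QW_field_holds` ⇒ `CossartJannsenSaito2020`; affine model by
  `exists_affineModel`; then `exists_regular_two_dominated_of_cjs`).
* `aeval_not_mem_of_not_mem`, `residuallyTranscendental_of_dominates_locPrime` — THREAD ADAPTER: for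
  a local `k`-subalgebra `T ⊆ K`, a prime `P` of `T`, and a valuation ring `W` dominating
  `locPrime T P = T_P`, every `x ∈ 𝔪_T ∖ P` is RESIDUALLY TRANSCENDENTAL in `W` (`f(x) ∉ P` for
  `f ≠ 0` by Horner induction — `f(x) = x·h(x) + f(0)` is a unit of `T` if `f(0) ≠ 0` — so `f(x)` is
  a unit of `T_P ⊆ W`).
* `exists_regular_two_dominated_of_thread` / **`hLU_of_cjs`** — the `hLU` binder VERBATIM
  `∀ W, O ≤ W → (∀ m, SubringDominates (locPrime (tower O A m) (P m) (hP m)) W) → (⋃-property) →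
   ¬ (W essentially of finite type over k) → ∃ R, IsRegularLocalRing R ∧ ringKrullDim R = 2 ∧
   IsFractionRing R K ∧ Algebra.EssFiniteType k R ∧ SubringDominates R W`,
  after partial application to: `CossartJannsenSaito2020`, the kernel datum `(O, A)` (`k ⊆ O`,
  `A ⊆ O` finitely generated, `Frac A = K`), `tr.deg_k K ≤ 3`, the thread `P`, and ONE stage with ONE
  element of `O`-value `< 1` off the thread prime — the «non-closed point» conjunct of
  `Parasite.SingularPrimeThread` verbatim (`∃ m s hs, O.valuation s < 1 ∧ ⟨s, hs⟩ ∉ P m`).  The union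
  hypothesis is not used.

References: V. Cossart, U. Jannsen, S. Saito, LNM 2270 (2020), Thm. 1.2 [`CossartJannsenSaito2020`].
-/

noncomputable section

-- single-problem summit: the doubled namespace component `ResolutionOfSingularities` is forced
set_option linter.dupNamespace false

namespace Summit.ResolutionOfSingularities.ResolutionOfSingularities.Theorems.NoZeno.CoarseningLU

open Literature.AlgebraicGeometry.Resolution IsLocalRing Polynomial
open Summit.ResolutionOfSingularities.ResolutionOfSingularities.Theorems

variable {k K : Type} [Field k] [Field K] [Algebra k K]

/-! ## (LU₂W) — the planner's `Sig.UnionLU`, verbatim -/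

/-- **(LU₂W) LOCAL UNIFORMIZATION OF A NON-ALGEBRAIC VALUATION RING WITH A RESIDUALLY TRANSCENDENTAL
ELEMENT, THREAD-FREE — planner res-L0-w44-plan-1's `Beta2Descent.Sig.UnionLU` (r3.3 `ceae213b88bd3acb`
l.999), TEXT VERBATIM, PROVED.**  `K/k` finitely generated of transcendence degree `3`, `W ∋ k` a
valuation ring of `K` with an element `w` all of whose non-zero `k`-polynomial values are units, `W`
not (the subring of) an essentially-finite-type `k`-subalgebra: then, given CJS Thm. 1.2 in printed
generality (`CossartJannsenSaito2020General`; excellence of finite-type algebras over a field is the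
tree THEOREM `Stacks07QW_field_holds`), `W` dominates a regular local `k`-subalgebra `R` of Krull
dimension `2`, essentially of finite type over `k`, with `Frac R = K`.  Proof: an affine model
`A ⊆ W` (`exists_affineModel`) and `exists_regular_two_dominated_of_cjs`.
[cite: CossartJannsenSaito2020, Thm. 1.2] -/
theorem unionLU :
    CossartJannsenSaito2020General.{0} →
    ∀ (k K : Type) [Field k] [Field K] [Algebra k K] (W : ValuationSubring K),
      (∀ c : k, algebraMap k K c ∈ W) → (⊤ : IntermediateField k K).FG → Algebra.trdeg k K = 3 →
      (∃ w : K, w ∈ W ∧ ∀ f : Polynomial k, f ≠ 0 → W.valuation (Polynomial.aeval w f) = 1) →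
      ¬ (∃ B : Subalgebra k K, B.toSubring = W.toSubring ∧ Algebra.EssFiniteType k ↥B) →
      ∃ R : Subalgebra k K, IsRegularLocalRing ↥R ∧ ringKrullDim ↥R = 2 ∧ IsFractionRing ↥R K ∧
        Algebra.EssFiniteType k ↥R ∧ SubringDominates R.toSubring W.toSubring := by
  intro hCJS k₀ K₀ _ _ _ W hk hfg htr hw hness
  obtain ⟨w, hwW, hw1⟩ := hw
  obtain ⟨A, hAW, hA, hfr⟩ := exists_affineModel k₀ K₀ hfg W hk
  exact exists_regular_two_dominated_of_cjs
    (CossartJannsenSaito2020General.cossartJannsenSaito2020 hCJS Stacks07QW_field_holds) W hk A hA hfr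
    hAW htr.le hwW (fun f hf => by rw [hw1 f hf]; exact lt_irrefl 1) hness

/-- The residually-transcendental binder in the unit form (`= 1`, planner's texts) gives the non-unit
form (`¬ < 1`, strategist's texts). [folklore] -/
theorem not_valuation_lt_one_of_eq_one (W : ValuationSubring K) {w : K}
    (hw1 : ∀ f : k[X], f ≠ 0 → W.valuation (aeval w f) = 1) :
    ∀ f : k[X], f ≠ 0 → ¬ W.valuation (aeval w f) < 1 :=
  fun f hf => by rw [hw1 f hf]; exact lt_irrefl 1

/-! ## Residually transcendental elements from a thread germ -/

open Summit.ResolutionOfSingularities.ResolutionOfSingularities.Theorems.NoZeno.SandwichCluster.Parasite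
  (locPrime mem_locPrime_of_mem inv_mem_locPrime_of_not_mem ne_zero_of_not_mem_ideal)

/-- In a local `k`-subalgebra `T ⊆ K`, a polynomial over `k` evaluated at a non-unit `x ∉ P`
(`P` a prime of `T`) stays outside `P` unless the polynomial is zero: `f(x) = x · h(x) + f(0)` is a
unit of `T` if `f(0) ≠ 0`, and `f(x) = g(x) · x` with `g(x) ∉ P` (induction) otherwise.
[this work] -/
theorem aeval_not_mem_of_not_mem (T : Subalgebra k K) [IsLocalRing ↥T] (P : Ideal ↥T)
    (hP : P.IsPrime) {x : K} (hxT : x ∈ T) (hxu : x⁻¹ ∉ T) (hxP : (⟨x, hxT⟩ : ↥T) ∉ P)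
    {f : k[X]} (hf : f ≠ 0) : (⟨aeval x f, aeval_mem_of_mem T hxT f⟩ : ↥T) ∉ P := by
  -- `x` lies in the maximal ideal of `T`
  have hxm : (⟨x, hxT⟩ : ↥T) ∈ maximalIdeal ↥T := by
    rw [mem_maximalIdeal, mem_nonunits_iff]
    intro hu
    exact hxu ((isUnit_subring_iff_inv_mem (R := T.toSubring) ⟨x, hxT⟩).mp hu).2
  -- the evaluation as an element of `T`
  have key : ∀ g : k[X], (⟨aeval x g, aeval_mem_of_mem T hxT g⟩ : ↥T) = aeval (⟨x, hxT⟩ : ↥T) g := by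
    intro g
    apply Subtype.ext
    change aeval x g = ((aeval (⟨x, hxT⟩ : ↥T) g : ↥T) : K)
    rw [Polynomial.aeval_subalgebra_coe g T ⟨x, hxT⟩]
  rw [key]
  revert hf
  refine Polynomial.recOnHorner f (fun h => absurd rfl h) ?_ ?_
  · -- `f = p + C a`, `p(0) = 0`, `a ≠ 0`: `f(x)` is a unit
    intro p a hp0 ha _ _ hmem
    apply hP.ne_top
    refine P.eq_top_of_isUnit_mem hmem ?_
    have hpx : aeval (⟨x, hxT⟩ : ↥T) p ∈ maximalIdeal ↥T := by
      have : p = X * p.divX := by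
        conv_lhs => rw [← Polynomial.X_mul_divX_add p, hp0, map_zero, add_zero]
      rw [this, map_mul, aeval_X]
      exact Ideal.mul_mem_right _ _ hxm
    have hau : IsUnit (aeval (⟨x, hxT⟩ : ↥T) (C a)) := by
      rw [aeval_C]
      exact (IsUnit.mk0 a ha).map _
    rw [map_add]
    -- unit + non-unit in a local ring
    by_contra hnu
    have hmem' : aeval (⟨x, hxT⟩ : ↥T) p + aeval (⟨x, hxT⟩ : ↥T) (C a) ∈ maximalIdeal ↥T := by
      rwa [mem_maximalIdeal, mem_nonunits_iff]
    have := sub_mem hmem' hpx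
    rw [add_sub_cancel_left] at this
    exact (mem_maximalIdeal _).mp this |> fun h => h hau
  · -- `f = p * X`, `p ≠ 0`
    intro p hp0 ih _ hmem
    rw [map_mul, aeval_X] at hmem
    rcases hP.mem_or_mem hmem with h | h
    · exact ih hp0 h
    · exact hxP h

/-- **A stage non-unit off the thread prime is residually transcendental in every valuation ring
dominating the thread germ.**  `T` a local `k`-subalgebra of `K`, `P` a prime of `T`, `W` a
valuation ring dominating `locPrime T P` (`= T_P ⊆ K`), `x ∈ 𝔪_T ∖ P`: then `x ∈ W` and no
non-zero polynomial in `x` over `k` is a non-unit of `W` (`f(x) ∉ P`, so `f(x)⁻¹ ∈ T_P ⊆ W`).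
For a thread germ `D_m = (T_m)_{P_m}` of a tower in transcendence degree `3` such `x` exist as soon
as `P_m ≠ 𝔪_{T_m}` (`ht P_m = 2 < 3 = dim T_m`). [this work] -/
theorem residuallyTranscendental_of_dominates_locPrime (W : ValuationSubring K)
    (T : Subalgebra k K) [IsLocalRing ↥T] (P : Ideal ↥T) (hP : P.IsPrime)
    (hdom : SubringDominates (locPrime T P hP) W.toSubring) {x : K} (hxT : x ∈ T)
    (hxu : x⁻¹ ∉ T) (hxP : (⟨x, hxT⟩ : ↥T) ∉ P) :
    x ∈ W ∧ ∀ f : k[X], f ≠ 0 → ¬ W.valuation (aeval x f) < 1 := by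
  refine ⟨hdom.1 (mem_locPrime_of_mem T P hP hxT), fun f hf hlt => ?_⟩
  have hfP := aeval_not_mem_of_not_mem T P hP hxT hxu hxP hf
  have hfT : aeval x f ∈ T := aeval_mem_of_mem T hxT f
  have hinv : (aeval x f)⁻¹ ∈ W := hdom.1 (inv_mem_locPrime_of_not_mem T P hP hfT hfP)
  have h1 : W.valuation (aeval x f) = 1 :=
    SyzygyFlattening.valuation_eq_one_of_inv_mem W (hdom.1 (mem_locPrime_of_mem T P hP hfT)) hinv
      (ne_zero_of_not_mem_ideal T P hfT hfP)
  exact absurd h1 (ne_of_lt hlt)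

/-! ## The `hLU` input of the exhaustive habitat entry, discharged -/

open Summit.ResolutionOfSingularities.ResolutionOfSingularities.Theorems.NoZeno.Birth

/-- **LU₂ for a coarsening dominating a thread germ**, modulo `CossartJannsenSaito2020`.  Data: the
kernel datum `(O, A)` (`k ⊆ O`, `A ⊆ O` finitely generated with `Frac A = K`), `tr.deg_k K ≤ 3`, a
family of primes `P m` of the stages with the «non-closed point» conjunct of
`Parasite.SingularPrimeThread` VERBATIM (ONE stage `m` with ONE `s ∈ T_m` of `O`-value `< 1` outside
`P m`), and a valuation ring `W ⊇ O` dominating the thread germs `(T_m)_{P m}` which is NOT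
essentially of finite type over `k`.  Conclusion: `W` dominates a regular local `k`-subalgebra of `K`
of Krull dimension `2`, essentially of finite type, with fraction field `K`.
[cite: CossartJannsenSaito2020, Thm. 1.2] -/
theorem exists_regular_two_dominated_of_thread (hCJS : CossartJannsenSaito2020.{0})
    (O : ValuationSubring K) (A : Subalgebra k K) (hk : ∀ c : k, algebraMap k K c ∈ O) (hA : A.FG)
    (hfr : IsFractionRing ↥A K) (hAO : A.toSubring ≤ O.toSubring) (htr : Algebra.trdeg k K ≤ 3)
    (P : ∀ m : ℕ, Ideal ↥(tower O A m)) (hP : ∀ m, (P m).IsPrime)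
    (hthread : ∃ (m : ℕ) (s : K) (hs : s ∈ tower O A m),
      O.valuation s < 1 ∧ (⟨s, hs⟩ : ↥(tower O A m)) ∉ P m)
    (W : ValuationSubring K) (hOW : O ≤ W)
    (hdom : ∀ m, SubringDominates (locPrime (tower O A m) (P m) (hP m)) W.toSubring)
    (hness : ¬ ∃ B : Subalgebra k K, B.toSubring = W.toSubring ∧ Algebra.EssFiniteType k ↥B) :
    ∃ R : Subalgebra k K, IsRegularLocalRing ↥R ∧ ringKrullDim ↥R = 2 ∧ IsFractionRing ↥R K ∧
      Algebra.EssFiniteType k ↥R ∧ SubringDominates R.toSubring W.toSubring := by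
  obtain ⟨m, s, hs, hslt, hsP⟩ := hthread
  haveI : IsLocalRing ↥(tower O A m) := by
    obtain ⟨B, hBO, hTB⟩ := exists_tower_eq_loc O A hk hAO m
    rw [hTB, loc_eq_locAt]
    exact SyzygyFlattening.isLocalRing_locAt O B hBO
  -- `s` of `O`-value `< 1` is a non-unit of the stage `T_m ⊆ O`
  have hsu : s⁻¹ ∉ tower O A m := by
    intro hsi
    have hsiO : s⁻¹ ∈ O := mem_valuationSubring_of_mem_tower O hk hAO m _ hsi
    have hs0 : s ≠ 0 := ne_zero_of_not_mem_ideal _ (P m) hs hsP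
    have h1 := SyzygyFlattening.valuation_eq_one_of_inv_mem O
      (mem_valuationSubring_of_mem_tower O hk hAO m _ hs) hsiO hs0
    exact absurd h1 (ne_of_lt hslt)
  obtain ⟨hsW, hwt⟩ :=
    residuallyTranscendental_of_dominates_locPrime W (tower O A m) (P m) (hP m) (hdom m) hs hsu hsP
  exact exists_regular_two_dominated_of_cjs hCJS W (fun c => hOW (hk c)) A hA hfr
    (fun y hy => hOW (hAO hy)) htr hsW hwt hness

/-- **(LU₂) DISCHARGED — the `hLU` binder of `NoZeno.Sandwiched.exists_isSandwichedGerm_of_exhausts`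
VERBATIM** (res-L0-w44-stub-3, re-cut 2026-08-27T13:32Z), after partial application to
`CossartJannsenSaito2020`, the kernel datum, `tr.deg_k K ≤ 3`, the thread primes and the «non-closed
point» witness of `Parasite.SingularPrimeThread`.  (The union hypothesis of the binder is not used.)
[cite: CossartJannsenSaito2020, Thm. 1.2] -/
theorem hLU_of_cjs (hCJS : CossartJannsenSaito2020.{0}) (O : ValuationSubring K)
    (A : Subalgebra k K) (hk : ∀ c : k, algebraMap k K c ∈ O) (hA : A.FG)
    (hfr : IsFractionRing ↥A K) (hAO : A.toSubring ≤ O.toSubring) (htr : Algebra.trdeg k K ≤ 3)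
    (P : ∀ m : ℕ, Ideal ↥(tower O A m)) (hP : ∀ m, (P m).IsPrime)
    (hthread : ∃ (m : ℕ) (s : K) (hs : s ∈ tower O A m),
      O.valuation s < 1 ∧ (⟨s, hs⟩ : ↥(tower O A m)) ∉ P m) :
    ∀ W : ValuationSubring K, O ≤ W →
      (∀ m, SubringDominates (locPrime (tower O A m) (P m) (hP m)) W.toSubring) →
      (∀ x ∈ W, ∃ m, x ∈ locPrime (tower O A m) (P m) (hP m)) →
      ¬ (∃ B : Subalgebra k K, B.toSubring = W.toSubring ∧ Algebra.EssFiniteType k ↥B) →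
      ∃ R : Subalgebra k K, IsRegularLocalRing ↥R ∧ ringKrullDim ↥R = 2 ∧ IsFractionRing ↥R K ∧
        Algebra.EssFiniteType k ↥R ∧ SubringDominates R.toSubring W.toSubring :=
  fun W hOW hdom _ hness =>
    exists_regular_two_dominated_of_thread hCJS O A hk hA hfr hAO htr P hP hthread W hOW hdom hness

end Summit.ResolutionOfSingularities.ResolutionOfSingularities.Theorems.NoZeno.CoarseningLU

end
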